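import Literature.AlgebraicGeometry.Resolution.WeightedCentreZKernelFlow
import HarnessLib

/-!
# Weighted centres — THEOREM A⁺: the datum of `𝔇 = π_r(X′)` on a bottom slot and the shape of `exp_{<p}(T𝔇)` there

Instrument for engine 1's `W(f)` TOY MODEL (cell `pub-rosobs`, LF-MODEL-eng1-g45 §6.2 THEOREM A⁺: "`𝔇(ε_z) = c(z)` on `L₁` … `z₁ ↦ z₁ + τ, z_i ↦ z_i` on `L₁`
(`𝔇^b(ε_z) = 0` for `b ≥ 2`: the data on `L₁` are constants)"), NOT a resolution theorem and NOT about the invariant of [AbramovichTemkinWlodarczyk2024].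

* `projDer_X_of_pure` — if `x(ε_z) = ε_z + c σ^r` then `π_r(x)` read as a derivation has the CONSTANT datum `𝔇(ε_z) = c`;
* `sigmaExp_X_of_apply_eq_C` — a derivation with constant datum `𝔇(ε_z) = c` has `exp_{<p}(T𝔇)(ε_z) = ε_z + c·T` (`u₀ = u₁ = 1`, `𝔇(c) = 0`): exactly the slot shape
  `φ (X y) = C (X y) + C (C c) * X` required by L7 (`KillCoordinates.not_classPinned_symm_apply`).

References: [Matsumura1987, §25, §27]; [Lang2002, Ch. IV §1]; [AbramovichTemkinWlodarczyk2024, §5.1 (p. 1575)].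
-/

namespace Literature.AlgebraicGeometry.Resolution.WeightedBlowup.BottomClimb

open Polynomial OrderFiltration LevelProjection ZKernel

variable {k : Type*} [CommRing k] {ι : Type*}

/-- **The datum of `𝔇 = π_r(x)` on a slot moved by a pure term is the constant `c`** (bookkeeping: `LevelProjection.proj_apply`, `ZKernel.projDer_X`).
[cite: Matsumura1987, §25; AbramovichTemkinWlodarczyk2024, §5.1 (p. 1575)] -/
theorem projDer_X_of_pure {x : (MvPolynomial ι k)[X] ≃+* (MvPolynomial ι k)[X]} {z : ι} {c : k} {r : ℕ}
    (hz : x (C (MvPolynomial.X z)) = C (MvPolynomial.X z) + C (MvPolynomial.C c) * X ^ r) :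
    projDer r x (MvPolynomial.X z) = MvPolynomial.C c := by
  rw [projDer_X, proj_apply, hz, add_sub_cancel_left, Polynomial.coeff_C_mul_X_pow, if_pos rfl]

/-- **`exp_{<p}(T𝔇)` on a slot with constant datum**: `𝔇(ε_z) = c ∈ k` (so `𝔇²(ε_z) = 𝔇(c) = 0`), `u₀·0! = u₁·1! = 1`, `p ≥ 2` ⇒ `exp_{<p}(T𝔇)(ε_z) = ε_z + c·T` — the
slot shape `φ (X y) = C (X y) + C (C c) * X` of L7 (bookkeeping on `coeff_sigmaExp_X`).  Instrument for engine 1's `W(f)` toy model, NOT a resolution theorem.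
[cite: Matsumura1987, §27 (pp. 207–209); Lang2002, Ch. IV §1] -/
theorem sigmaExp_X_of_apply_eq_C {p : ℕ} {u : ℕ → k} (hu : ∀ n < p, (Nat.factorial n : k) * u n = 1) (hp : 2 ≤ p)
    {D : Derivation k (MvPolynomial ι k) (MvPolynomial ι k)} {z : ι} {c : k} (hDz : D (MvPolynomial.X z) = MvPolynomial.C c) :
    sigmaExp D p u (MvPolynomial.X z) = C (MvPolynomial.X z) + C (MvPolynomial.C c) * X := by
  have hu0 : u 0 = 1 := by have h := hu 0 (by omega); rwa [Nat.factorial_zero, Nat.cast_one, one_mul] at h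
  have hu1 : u 1 = 1 := by have h := hu 1 (by omega); rwa [Nat.factorial_one, Nat.cast_one, one_mul] at h
  have hDc : D (MvPolynomial.C c) = 0 := by rw [← MvPolynomial.algebraMap_eq]; exact D.map_algebraMap c
  have hD2 : ∀ m, D^[m + 2] (MvPolynomial.X z) = 0 := fun m => by
    induction m with
    | zero => rw [zero_add, Function.iterate_succ_apply', Function.iterate_one, hDz, hDc]
    | succ m ih => rw [show m + 1 + 2 = (m + 2) + 1 by omega, Function.iterate_succ_apply', ih, map_zero]
  refine Polynomial.ext fun n => ?_
  rw [coeff_sigmaExp_X, coeff_add, coeff_C, Polynomial.coeff_C_mul_X]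
  rcases Nat.lt_or_ge n 2 with hn | hn
  · interval_cases n
    · rw [if_pos (by omega), if_pos rfl, if_neg zero_ne_one, hu0, one_smul, Function.iterate_zero_apply, add_zero]
    · rw [if_pos (by omega), if_neg one_ne_zero, if_pos rfl, hu1, one_smul, Function.iterate_one, hDz, zero_add]
  · obtain ⟨m, rfl⟩ := Nat.exists_eq_add_of_le' hn
    rw [hD2 m, smul_zero, ite_self, if_neg (by omega), if_neg (by omega), add_zero]

end Literature.AlgebraicGeometry.Resolution.WeightedBlowup.BottomClimb
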